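import Mathlib
import Summits.Ventures.PercRepro2.RootCutTheorem

/-!
# The mark `a₃` alone behind an unmarked cut vertex: the typed one-far-`a₃` rule (blind cell PercRepro2,
p3 g3, 2026-08-25; `proofs/P3-BRIDGE.md` §11.10–11.11)

CLASS (`CutFarA3`): an unmarked cut vertex `c` of the support separates `VH ∋ o, a₁, a₂, b` from
`VL ∋ a₃`.  A copy's state is the root-side state with `c` as `a₃`, its `a₃`-coordinates gated by the
far bit `g = 1[c ↔ a₃]` (`st_eq_gluedA`); sorting the triples by the far PATTERN `S` of copies with
`g = 1`, **`typedCount F z τ K₃ = (e₀·P₀ + e₁·P₁ + e₂·P₂ + e₃·P₃)·(inert)`** (`typedCount_eq_cutFarA3`)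
with `e_k ≥ 0` the far count of a size-`k` pattern and `P_k` the root-side counts summed over the
size-`k` patterns: `P₀` = the `a₃`-inactive instance (`a₃` absent), `P₃` = the typed base of the smaller
instance with `c` renamed `a₃` (`count_P3A_eq`), `P₁`, `P₂` = the typed bases of «`a₃` pendant at `c` by a
type-1 / type-2 edge» (the leaf row's coefficients); row 2′TRI on the class follows from the four
gadgets (`typedCount_nonneg_of_cutFarA3`).  Own work; standard axioms. -/

namespace Summit.Ventures.PercRepro2

open UnionCluster

namespace CovForm

namespace RootBridge

open OneTyped TypedA3 Untouched TypedFactor Separated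

/-! ## The states -/
section States

/-- The state of a copy when `a₃` alone sits beyond `c`: the root-side state with `c` in the role
of `a₃`, its `a₃`-coordinates gated by the far bit `g = 1[c ↔ a₃]`. -/
def gluedA (h : St) (g : Bool) : St :=
  (h.q', h.Lo, h.Ho, h.Lb, h.Hb, h.L3 && g, h.H3 && g)

/-- The kernel on root-side states glued with a fixed far pattern `(sx, sy, sw)`. -/
def patA (sx sy sw : Bool) (hx hy hw : St) : ℤ :=
  KB (gluedA hx sx) (gluedA hy sy) (gluedA hw sw)

/-- The indicator of the exact far pattern `(sx, sy, sw)`. -/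
def exactA (sx sy sw gx gy gw : Bool) : ℤ :=
  (if gx = sx then 1 else 0) * (if gy = sy then 1 else 0) * (if gw = sw then 1 else 0)

/-- **The kernel on glued states, sorted by the far pattern**: exactly one pattern indicator is
`1`. -/
theorem KB_gluedA (hx hy hw : St) (gx gy gw : Bool) :
    KB (gluedA hx gx) (gluedA hy gy) (gluedA hw gw) =
      patA false false false hx hy hw * exactA false false false gx gy gw +
      patA true false false hx hy hw * exactA true false false gx gy gw +
      patA false true false hx hy hw * exactA false true false gx gy gw +
      patA false false true hx hy hw * exactA false false true gx gy gw +
      patA true true false hx hy hw * exactA true true false gx gy gw +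
      patA true false true hx hy hw * exactA true false true gx gy gw +
      patA false true true hx hy hw * exactA false true true gx gy gw +
      patA true true true hx hy hw * exactA true true true gx gy gw := by
  cases gx <;> cases gy <;> cases gw <;> simp [patA, exactA]

end States

/-! ## The class, the states of the support and the rule -/
section Main

open Classical

variable {V : Type*} {E : Type*} [Fintype E] [DecidableEq E] {R : Type*} [Field R]
  [LinearOrder R] [IsStrictOrderedRing R]
variable (ends : E → Sym2 V) (o a₁ a₂ a₃ b c : V)

/-- **`a₃` alone behind an unmarked cut vertex `c`**: the support graph `z ∪ F` splits into a side
`VH ∋ o, a₁, a₂, b` and a side `VL ∋ a₃` meeting only in `c`, no typed edge inside both sides, `c`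
none of the five marks. -/
structure CutFarA3 (VL VH : Set V) (F : Finset E) (z : Config E) : Prop where
  split : ∀ e, zF F z e = true → e ∈ within ends VL ∨ e ∈ within ends VH
  cap : ∀ t, t ∈ VL → t ∈ VH → t = c
  noloop : ∀ e ∈ F, ¬ (e ∈ within ends VL ∧ e ∈ within ends VH)
  cL : c ∈ VL
  cH : c ∈ VH
  oH : o ∈ VH
  a1H : a₁ ∈ VH
  a2H : a₂ ∈ VH
  bH : b ∈ VH
  a3L : a₃ ∈ VL
  oc : o ≠ c
  a1c : a₁ ≠ c
  a2c : a₂ ≠ c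
  bc : b ≠ c
  a3c : a₃ ≠ c

omit [Fintype E] [LinearOrder R] [IsStrictOrderedRing R] in
/-- A configuration below `z ∪ F` has its open edges within a side. -/
lemma CutFarA3.split_of_le {VL VH : Set V} {F : Finset E} {z : Config E}
    (h : CutFarA3 ends o a₁ a₂ a₃ b c VL VH F z) {x : Config E} (hx : x ≤ zF F z) :
    ∀ e, x e = true → e ∈ within ends VL ∨ e ∈ within ends VH := fun e he =>
  h.split e (by have := hx e; rw [he] at this; exact Bool.eq_true_of_true_le this)

omit [Fintype E] [LinearOrder R] [IsStrictOrderedRing R] in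
/-- **The state of a copy of the support**: the root-side state of the instance with `c` renamed
`a₃`, gated by the far bit `1[c ↔ a₃]`. -/
theorem st_eq_gluedA {VL VH : Set V} {F : Finset E} {z : Config E}
    (h : CutFarA3 ends o a₁ a₂ a₃ b c VL VH F z) {x : Config E} (hx : ∀ e, e ∉ F → x e = z e) :
    st ends o a₁ a₂ a₃ b x =
      gluedA (st ends o a₁ a₂ c b (withinRestr ends VH x))
        (decide (Conn ends (withinRestr ends VL x) c a₃)) := by
  have hsp := CutFarA3.split_of_le ends o a₁ a₂ a₃ b c h (le_zF hx)
  have hsp' : ∀ e, x e = true → e ∈ within ends VH ∨ e ∈ within ends VL := fun e he =>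
    (hsp e he).symm
  have hcap' : ∀ t, t ∈ VH → t ∈ VL → t = c := fun t h1 h2 => h.cap t h2 h1
  unfold st gluedA St.q' St.Lo St.Ho St.Lb St.Hb St.L3 St.H3
  have e1 := conn_side ends hsp' hcap' h.a2H h.a1H
  have e2 := conn_side ends hsp' hcap' h.a1H h.oH
  have e3 := conn_side ends hsp' hcap' h.a2H h.oH
  have e4 := conn_side ends hsp' hcap' h.a1H h.bH
  have e5 := conn_side ends hsp' hcap' h.a2H h.bH
  have e6 := conn_cross ends hsp' hcap' ⟨h.cH, h.cL⟩ h.a1H h.a3L h.a3c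
  have e7 := conn_cross ends hsp' hcap' ⟨h.cH, h.cL⟩ h.a2H h.a3L h.a3c
  rw [decide_eq_decide.mpr e1, decide_eq_decide.mpr e2, decide_eq_decide.mpr e3,
    decide_eq_decide.mpr e4, decide_eq_decide.mpr e5, decide_eq_decide.mpr e6,
    decide_eq_decide.mpr e7]
  · simp only [Bool.decide_and]
  all_goals infer_instance

/-- The root-side kernel of a fixed far pattern, read on the root side. -/
noncomputable def hKA (VH : Set V) (sx sy sw : Bool) : Config E → Config E → Config E → R :=
  fun x y w => ((patA sx sy sw (st ends o a₁ a₂ c b (withinRestr ends VH x))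
    (st ends o a₁ a₂ c b (withinRestr ends VH y)) (st ends o a₁ a₂ c b (withinRestr ends VH w)) : ℤ) : R)

/-- The far-side kernel of the exact pattern `(sx, sy, sw)`. -/
noncomputable def lKA (VL : Set V) (sx sy sw : Bool) : Config E → Config E → Config E → R :=
  fun x y w => ((exactA sx sy sw (decide (Conn ends (withinRestr ends VL x) c a₃))
    (decide (Conn ends (withinRestr ends VL y) c a₃))
    (decide (Conn ends (withinRestr ends VL w) c a₃)) : ℤ) : R)

omit [Fintype E] [LinearOrder R] [IsStrictOrderedRing R] in
/-- **`K₃` on the support** when `a₁` alone sits beyond `c`: the eight-pattern form. -/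
theorem K3_eq_cutFarA3 {VL VH : Set V} {F : Finset E} {z : Config E}
    (h : CutFarA3 ends o a₁ a₂ a₃ b c VL VH F z) {x y w : Config E}
    (hx : ∀ e, e ∉ F → x e = z e) (hy : ∀ e, e ∉ F → y e = z e) (hw : ∀ e, e ∉ F → w e = z e) :
    (K3 ends o a₁ a₂ a₃ b x y w : R) =
      lKA ends a₃ c VL false false false (restr (sideF ends VL F) z x) (restr (sideF ends VL F) z y)
          (restr (sideF ends VL F) z w) * hKA ends o a₁ a₂ b c VH false false false
          (restr (sideF ends VH F) z x) (restr (sideF ends VH F) z y) (restr (sideF ends VH F) z w) +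
      lKA ends a₃ c VL true false false (restr (sideF ends VL F) z x) (restr (sideF ends VL F) z y)
          (restr (sideF ends VL F) z w) * hKA ends o a₁ a₂ b c VH true false false
          (restr (sideF ends VH F) z x) (restr (sideF ends VH F) z y) (restr (sideF ends VH F) z w) +
      lKA ends a₃ c VL false true false (restr (sideF ends VL F) z x) (restr (sideF ends VL F) z y)
          (restr (sideF ends VL F) z w) * hKA ends o a₁ a₂ b c VH false true false
          (restr (sideF ends VH F) z x) (restr (sideF ends VH F) z y) (restr (sideF ends VH F) z w) +
      lKA ends a₃ c VL false false true (restr (sideF ends VL F) z x) (restr (sideF ends VL F) z y)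
          (restr (sideF ends VL F) z w) * hKA ends o a₁ a₂ b c VH false false true
          (restr (sideF ends VH F) z x) (restr (sideF ends VH F) z y) (restr (sideF ends VH F) z w) +
      lKA ends a₃ c VL true true false (restr (sideF ends VL F) z x) (restr (sideF ends VL F) z y)
          (restr (sideF ends VL F) z w) * hKA ends o a₁ a₂ b c VH true true false
          (restr (sideF ends VH F) z x) (restr (sideF ends VH F) z y) (restr (sideF ends VH F) z w) +
      lKA ends a₃ c VL true false true (restr (sideF ends VL F) z x) (restr (sideF ends VL F) z y)
          (restr (sideF ends VL F) z w) * hKA ends o a₁ a₂ b c VH true false true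
          (restr (sideF ends VH F) z x) (restr (sideF ends VH F) z y) (restr (sideF ends VH F) z w) +
      lKA ends a₃ c VL false true true (restr (sideF ends VL F) z x) (restr (sideF ends VL F) z y)
          (restr (sideF ends VL F) z w) * hKA ends o a₁ a₂ b c VH false true true
          (restr (sideF ends VH F) z x) (restr (sideF ends VH F) z y) (restr (sideF ends VH F) z w) +
      lKA ends a₃ c VL true true true (restr (sideF ends VL F) z x) (restr (sideF ends VL F) z y)
          (restr (sideF ends VL F) z w) * hKA ends o a₁ a₂ b c VH true true true
          (restr (sideF ends VH F) z x) (restr (sideF ends VH F) z y) (restr (sideF ends VH F) z w) := by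
  rw [K3_eq_KB, st_eq_gluedA ends o a₁ a₂ a₃ b c h hx, st_eq_gluedA ends o a₁ a₂ a₃ b c h hy,
    st_eq_gluedA ends o a₁ a₂ a₃ b c h hw, KB_gluedA]
  unfold hKA lKA
  rw [withinRestr_restr_eq ends VH hx, withinRestr_restr_eq ends VH hy,
    withinRestr_restr_eq ends VH hw, withinRestr_restr_eq ends VL hx,
    withinRestr_restr_eq ends VL hy, withinRestr_restr_eq ends VL hw]
  push_cast
  ring

omit [Fintype E] [DecidableEq E] [LinearOrder R] [IsStrictOrderedRing R] in
/-- Gluing with `g = true` is the identity. -/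
lemma gluedA_true (h : St) : gluedA h true = h := by
  rcases h with ⟨q, lo, ho, lb, hb, l3, h3⟩
  simp [gluedA, St.q', St.Lo, St.Ho, St.Lb, St.Hb, St.L3, St.H3]

omit [Fintype E] [LinearOrder R] [IsStrictOrderedRing R] in
/-- The state of the root-side instance only sees the root side. -/
lemma st_sideA {VL VH : Set V} {F : Finset E} {z : Config E}
    (h : CutFarA3 ends o a₁ a₂ a₃ b c VL VH F z) {x : Config E} (hx : x ≤ zF F z) :
    st ends o a₁ a₂ c b x = st ends o a₁ a₂ c b (withinRestr ends VH x) := by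
  have hsp := CutFarA3.split_of_le ends o a₁ a₂ a₃ b c h hx
  have hsp' : ∀ e, x e = true → e ∈ within ends VH ∨ e ∈ within ends VL := fun e he =>
    (hsp e he).symm
  have hcap' : ∀ t, t ∈ VH → t ∈ VL → t = c := fun t h1 h2 => h.cap t h2 h1
  unfold st
  rw [decide_eq_decide.mpr (conn_side ends hsp' hcap' h.a2H h.a1H),
    decide_eq_decide.mpr (conn_side ends hsp' hcap' h.a1H h.oH),
    decide_eq_decide.mpr (conn_side ends hsp' hcap' h.a2H h.oH),
    decide_eq_decide.mpr (conn_side ends hsp' hcap' h.a1H h.bH),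
    decide_eq_decide.mpr (conn_side ends hsp' hcap' h.a2H h.bH),
    decide_eq_decide.mpr (conn_side ends hsp' hcap' h.a1H h.cH),
    decide_eq_decide.mpr (conn_side ends hsp' hcap' h.a2H h.cH)]

omit [LinearOrder R] [IsStrictOrderedRing R] in
/-- **`P₃`**: the all-glued root-side count is the typed base of the instance with `c` renamed
`a₃`. -/
lemma count_P3A_eq {VL VH : Set V} {F : Finset E} {z : Config E} (τ : E → ℕ)
    (h : CutFarA3 ends o a₁ a₂ a₃ b c VL VH F z) :
    typedCount (sideF ends VH F) z τ
        (hKA ends o a₁ a₂ b c VH true true true : Config E → Config E → Config E → R) =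
      typedCount (sideF ends VH F) z τ (K3 ends o a₁ a₂ c b : Config E → Config E → Config E → R) := by
  refine typedCount_congr_on_support _ z τ fun x y w hc _ => ?_
  have hBF : sideF ends VH F ⊆ F := Finset.filter_subset _ _
  have hle : ∀ v : Config E, (∀ e, e ∉ sideF ends VH F → v e = z e) → v ≤ zF F z := fun v hv =>
    le_zF fun e he => hv e fun hB => he (hBF hB)
  unfold hKA patA
  rw [gluedA_true, gluedA_true, gluedA_true, K3_eq_KB,
    st_sideA ends o a₁ a₂ a₃ b c h (hle x fun e he => (hc e he).1),
    st_sideA ends o a₁ a₂ a₃ b c h (hle y fun e he => (hc e he).2.1),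
    st_sideA ends o a₁ a₂ a₃ b c h (hle w fun e he => (hc e he).2.2)]

omit [LinearOrder R] [IsStrictOrderedRing R] in
/-- The far-side exact-pattern counts depend on the pattern's size only (copy symmetry). -/
lemma count_lKA_symm (VL : Set V) (A : Finset E) (z : Config E) (τ : E → ℕ)
    (hτ : ∀ e ∈ A, τ e = 1 ∨ τ e = 2) :
    typedCount A z τ (lKA ends a₃ c VL true false false : Config E → Config E → Config E → R) =
        typedCount A z τ (lKA ends a₃ c VL false false true) ∧
      typedCount A z τ (lKA ends a₃ c VL false true false : Config E → Config E → Config E → R) =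
        typedCount A z τ (lKA ends a₃ c VL false false true) ∧
      typedCount A z τ (lKA ends a₃ c VL true true false : Config E → Config E → Config E → R) =
        typedCount A z τ (lKA ends a₃ c VL false true true) ∧
      typedCount A z τ (lKA ends a₃ c VL true false true : Config E → Config E → Config E → R) =
        typedCount A z τ (lKA ends a₃ c VL false true true) := by
  refine ⟨?_, ?_, ?_, ?_⟩
  · rw [← typedCount_swap13 A z τ hτ (lKA ends a₃ c VL false false true)]
    exact typedCount_congr' _ _ _ _ _ fun x y w => by unfold lKA exactA; push_cast; ring
  · rw [← typedCount_swap23 A z τ hτ (lKA ends a₃ c VL false false true)]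
    exact typedCount_congr' _ _ _ _ _ fun x y w => by unfold lKA exactA; push_cast; ring
  · rw [← typedCount_swap13 A z τ hτ (lKA ends a₃ c VL false true true)]
    exact typedCount_congr' _ _ _ _ _ fun x y w => by unfold lKA exactA; push_cast; ring
  · rw [← typedCount_swap12 A z τ (lKA ends a₃ c VL false true true)]
    exact typedCount_congr' _ _ _ _ _ fun x y w => by unfold lKA exactA; push_cast; ring

omit [LinearOrder R] [IsStrictOrderedRing R] in
/-- **THE TYPED ONE-FAR-`a₃` RULE**: sorting by the far pattern,
`typedCount F z τ K₃ = (e₁ · P₁ + e₂ · P₂ + e₃ · P₃) · (inert count)`, `e_k` the far count of a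
pattern of size `k`, `P_k` the sum of the root-side counts over the patterns of size `k`
(`P₀ = 0`). -/
theorem typedCount_eq_cutFarA3 {VL VH : Set V} (F : Finset E) (z : Config E) (τ : E → ℕ)
    (hτ : ∀ e ∈ F, τ e = 1 ∨ τ e = 2) (h : CutFarA3 ends o a₁ a₂ a₃ b c VL VH F z) :
    typedCount F z τ (K3 ends o a₁ a₂ a₃ b : Config E → Config E → Config E → R) =
      (typedCount (sideF ends VL F) z τ (lKA ends a₃ c VL false false false) *
          typedCount (sideF ends VH F) z τ (hKA ends o a₁ a₂ b c VH false false false) +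
        typedCount (sideF ends VL F) z τ (lKA ends a₃ c VL false false true) *
          (typedCount (sideF ends VH F) z τ (hKA ends o a₁ a₂ b c VH true false false) +
            typedCount (sideF ends VH F) z τ (hKA ends o a₁ a₂ b c VH false true false) +
            typedCount (sideF ends VH F) z τ (hKA ends o a₁ a₂ b c VH false false true)) +
        typedCount (sideF ends VL F) z τ (lKA ends a₃ c VL false true true) *
          (typedCount (sideF ends VH F) z τ (hKA ends o a₁ a₂ b c VH true true false) +
            typedCount (sideF ends VH F) z τ (hKA ends o a₁ a₂ b c VH true false true) +
            typedCount (sideF ends VH F) z τ (hKA ends o a₁ a₂ b c VH false true true)) +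
        typedCount (sideF ends VL F) z τ (lKA ends a₃ c VL true true true) *
          typedCount (sideF ends VH F) z τ (K3 ends o a₁ a₂ c b)) *
        typedCount (F \ (sideF ends VL F ∪ sideF ends VH F)) z τ (fun _ _ _ => (1 : R)) := by
  set A := sideF ends VL F with hA
  set B := sideF ends VH F with hB
  set C := F \ (A ∪ B) with hC
  have hAF : A ⊆ F := Finset.filter_subset _ _
  have hBF : B ⊆ F := Finset.filter_subset _ _
  have hAB : Disjoint A B := by
    rw [Finset.disjoint_left]
    intro e heA heB
    simp only [hA, hB, sideF, Finset.mem_filter] at heA heB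
    exact h.noloop e heA.1 ⟨heA.2, heB.2⟩
  have hABF : A ∪ B ⊆ F := Finset.union_subset hAF hBF
  have hAC : Disjoint A C := Finset.disjoint_of_subset_left Finset.subset_union_left Finset.disjoint_sdiff
  have hBC : Disjoint B C := Finset.disjoint_of_subset_left Finset.subset_union_right Finset.disjoint_sdiff
  have hF : A ∪ B ∪ C = F := Finset.union_sdiff_of_subset hABF
  have hτA : ∀ e ∈ A, τ e = 1 ∨ τ e = 2 := fun e he => hτ e (hAF he)
  have hker : typedCount F z τ (K3 ends o a₁ a₂ a₃ b : Config E → Config E → Config E → R) =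
      typedCount F z τ (fun x y w =>
        lKA ends a₃ c VL false false false (restr A z x) (restr A z y) (restr A z w) *
            hKA ends o a₁ a₂ b c VH false false false (restr B z x) (restr B z y) (restr B z w) +
          lKA ends a₃ c VL true false false (restr A z x) (restr A z y) (restr A z w) *
            hKA ends o a₁ a₂ b c VH true false false (restr B z x) (restr B z y) (restr B z w) +
          lKA ends a₃ c VL false true false (restr A z x) (restr A z y) (restr A z w) *
            hKA ends o a₁ a₂ b c VH false true false (restr B z x) (restr B z y) (restr B z w) +
          lKA ends a₃ c VL false false true (restr A z x) (restr A z y) (restr A z w) *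
            hKA ends o a₁ a₂ b c VH false false true (restr B z x) (restr B z y) (restr B z w) +
          lKA ends a₃ c VL true true false (restr A z x) (restr A z y) (restr A z w) *
            hKA ends o a₁ a₂ b c VH true true false (restr B z x) (restr B z y) (restr B z w) +
          lKA ends a₃ c VL true false true (restr A z x) (restr A z y) (restr A z w) *
            hKA ends o a₁ a₂ b c VH true false true (restr B z x) (restr B z y) (restr B z w) +
          lKA ends a₃ c VL false true true (restr A z x) (restr A z y) (restr A z w) *
            hKA ends o a₁ a₂ b c VH false true true (restr B z x) (restr B z y) (restr B z w) +
          lKA ends a₃ c VL true true true (restr A z x) (restr A z y) (restr A z w) *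
            hKA ends o a₁ a₂ b c VH true true true (restr B z x) (restr B z y) (restr B z w)) := by
    refine typedCount_congr_on_support F z τ fun x y w hc _ => ?_
    exact K3_eq_cutFarA3 ends o a₁ a₂ a₃ b c h (fun e he => (hc e he).1)
      (fun e he => (hc e he).2.1) (fun e he => (hc e he).2.2)
  rw [hker, typedCount_add', typedCount_add', typedCount_add', typedCount_add',
    typedCount_add', typedCount_add', typedCount_add']
  have hm : ∀ sx sy sw : Bool, typedCount (A ∪ B ∪ C) z τ (fun x y w =>
      lKA ends a₃ c VL sx sy sw (restr A z x) (restr A z y) (restr A z w) *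
        hKA ends o a₁ a₂ b c VH sx sy sw (restr B z x) (restr B z y) (restr B z w)) =
      typedCount A z τ (lKA ends a₃ c VL sx sy sw) *
        typedCount B z τ (hKA ends o a₁ a₂ b c VH sx sy sw) *
        typedCount C z τ (fun _ _ _ => (1 : R)) := fun sx sy sw =>
    typedCount_mul_three A B C hAB hAC hBC z τ (lKA ends a₃ c VL sx sy sw)
      (hKA ends o a₁ a₂ b c VH sx sy sw : Config E → Config E → Config E → R)
  rw [hF] at hm
  rw [hm false false false, hm true false false, hm false true false, hm false false true,
    hm true true false, hm true false true, hm false true true, hm true true true]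
  obtain ⟨s1, s2, s3, s4⟩ := count_lKA_symm (R := R) ends a₃ c VL A z τ hτA
  rw [s1, s2, s3, s4, count_P3A_eq (R := R) ends o a₁ a₂ a₃ b c τ h]
  rw [← hB]
  ring

/-- **Row 2′TRI when `a₃` sits alone behind an unmarked cut vertex** follows from row 2′TRI on
the four gadgets: `a₃` absent (`P₀`), pendant at `c` by a type-1 edge (`P₁`), by a type-2 edge (`P₂`),
and the smaller instance with `c` renamed `a₃` (`P₃`). -/
theorem typedCount_nonneg_of_cutFarA3 {VL VH : Set V} (F : Finset E) (z : Config E) (τ : E → ℕ)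
    (hτ : ∀ e ∈ F, τ e = 1 ∨ τ e = 2) (h : CutFarA3 ends o a₁ a₂ a₃ b c VL VH F z)
    (h0 : 0 ≤ typedCount (sideF ends VH F) z τ
        (hKA ends o a₁ a₂ b c VH false false false : Config E → Config E → Config E → R))
    (h1 : 0 ≤ typedCount (sideF ends VH F) z τ
        (hKA ends o a₁ a₂ b c VH true false false : Config E → Config E → Config E → R) +
      typedCount (sideF ends VH F) z τ (hKA ends o a₁ a₂ b c VH false true false) +
      typedCount (sideF ends VH F) z τ (hKA ends o a₁ a₂ b c VH false false true))
    (h2 : 0 ≤ typedCount (sideF ends VH F) z τ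
        (hKA ends o a₁ a₂ b c VH true true false : Config E → Config E → Config E → R) +
      typedCount (sideF ends VH F) z τ (hKA ends o a₁ a₂ b c VH true false true) +
      typedCount (sideF ends VH F) z τ (hKA ends o a₁ a₂ b c VH false true true))
    (h3 : 0 ≤ typedCount (sideF ends VH F) z τ
        (K3 ends o a₁ a₂ c b : Config E → Config E → Config E → R)) :
    0 ≤ typedCount F z τ (K3 ends o a₁ a₂ a₃ b : Config E → Config E → Config E → R) := by
  rw [typedCount_eq_cutFarA3 ends o a₁ a₂ a₃ b c F z τ hτ h]
  have hL : ∀ sx sy sw : Bool, (0 : R) ≤ typedCount (sideF ends VL F) z τ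
      (lKA ends a₃ c VL sx sy sw) := fun sx sy sw => by
    refine typedCount_nonneg_of_nonneg _ _ _ fun x y w => ?_
    unfold lKA exactA
    push_cast
    refine mul_nonneg (mul_nonneg ?_ ?_) ?_ <;> split_ifs <;> simp
  have hI : (0 : R) ≤ typedCount (F \ (sideF ends VL F ∪ sideF ends VH F)) z τ
      (fun _ _ _ => (1 : R)) :=
    typedCount_nonneg_of_nonneg _ _ _ fun _ _ _ => zero_le_one
  refine mul_nonneg ?_ hI
  exact add_nonneg (add_nonneg (add_nonneg (mul_nonneg (hL false false false) h0)
    (mul_nonneg (hL false false true) h1)) (mul_nonneg (hL false true true) h2))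
    (mul_nonneg (hL true true true) h3)

end Main

end RootBridge

end CovForm

end Summit.Ventures.PercRepro2
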